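import Literature.AlgebraicGeometry.Resolution.InseparableLocalUniformizationStepThree
import Literature.AlgebraicGeometry.Resolution.InseparableLocalUniformizationWeakConclusion
import Literature.AlgebraicGeometry.Resolution.SmoothEquivalenceNormalizationProofs
import Literature.AlgebraicGeometry.Resolution.SmoothUniformization
import Literature.AlgebraicGeometry.Resolution.InseparableLocalUniformizationCurvesStepOne
import Literature.AlgebraicGeometry.Resolution.SmoothDescentField
import HarnessLib

/-!
# Inseparable local uniformization: Step 4 of the proof of Thm. 4.1.1 (Temkin 2013), proved

Topic: `Literature/AlgebraicGeometry/Resolution`. M. Temkin, *Inseparable local uniformization*,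
J. Algebra 373 (2013) 65–119 = arXiv:0804.1554v3 (numbering of this version; in the 41-pp.
arXiv version held in the literature store the proof of Thm. 4.1.1 is on pp. 29–30 and
Lemma 2.8.5 is Lemma 2.7.5). This file PROVES **Step 4** of the proof of Thm. 4.1.1 (p. 49 of
v3, p. 30 of the held copy), for `n = 1`, in the affine vocabulary of the corrected Steps 3–4
fact `Temkin2013_Steps34_tower` (`InseparableLocalUniformizationEngineTower.lean`), up to — but
not including — the final enlargement of `l` that makes the smooth centre simple:

  "Step 4. Smoothen the points `yᵢ` by an additional refining of `Y` and a purely inseparable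
  extension of `k̄`. Since `D_{k̄/k} = D - 1`, the induction assumption applies to the scheme
  `Y` and the valued `k̄`-fields `mᵢ`. So, there exists an affine refinement, which without loss
  of generality can be denoted `Y_α → Y`, and finite purely inseparable extensions of valued
  fields `l/k` and `l̄/lk̄` such that for each `i` the center of the valued field `l̄mᵢ` on
  `Nr_{l̄mᵢ}(Y_α)` is `l`-smooth. Refining `Y` we can assume that `Y = Y_α` … Next, we extend `k̄`
  as follows: replace `k̄`, `mᵢ`, `K`, `Kᵢ` with `l̄`, `l̄mᵢ`, `l̄K`, `l̄Kᵢ`, respectively; replace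
  `Y`, `Yᵢ`, `X`, `Xᵢ` with their normalizations in these fields, respectively; and update `xᵢ`
  and `yᵢ`, accordingly. Then (the new) `yᵢ` is `l`-smooth by the construction and `xᵢ` is still
  smooth-equivalent to `yᵢ` by Lemma 2.8.5 (we can take `Y` for the base scheme `S` in the
  Lemma). Thus, we achieve that the center of each `Kᵢ` on `Xᵢ` is `l`-smooth".

* `step4_weakConclusion` — PROVED, unconditionally, from the discharged Lemma 2.8.5
  (`Temkin2013_Lemma285_normal_holds`) and the PROVED field case of descent of smoothness along
  smooth covers (`AreSmoothEquivalent.isSmoothAt_left_of_field'`, `SmoothDescentField.lean`;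
  the general Tag 05B5 is the named fact `Stacks05B5`, not needed here): given the level-`B′` smooth-equivalence produced by
  Step 3 (`step3_exists_level`) between the centre `x` of `K₁°` on `X₁′ = Nr_{K₁}(X′)`,
  `X′ = Spec A ⊇ B′`, and the centre `y` of `m°` on `Y₁′ = Nr_m(Y′)`, `Y′ = Spec B′`, and given the
  output of Thm. 4.1.1 for `(Y′, k̄°)` and the valued extension `(m, m°)` — a finite purely
  inseparable `m′ = l̄m ⊇ m` with `l ⊆ l̄ ⊆ m′` (`l/k`, `l̄/k̄` finite purely inseparable), the
  valuation ring `m′°` over `m°`, and the `l`-smooth centre `y′` of `m′°` on `Nr_{m′}(Y′)` — the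
  weak conclusion `Temkin2013DescentConclusionWeak k K K° A K₁ K₁°` holds: with
  `L₁ = K₁·l̄` (the compositum inside an algebraic closure of `K₁`), `L₁°` over `K₁°`,
  `L = K(l̄) ⊇ l`, and `N = Nr_{L₁}(A)`, the centre `x′` of `L₁°` on `Spec N` is `l`-smooth.
  Proof as printed: `x′` and `y′` lie over `x` and `y` (`X₁′`, `Y₁′` are normal), so they are
  smooth-equivalent over `Y′` by Lemma 2.8.5; hence over `Spec k` and — the common smooth cover
  being reduced and `l/k` purely inseparable — over `Spec l`
  (`AreSmoothEquivalent.of_comp_of_forall_pow_mem`), and a point smooth-equivalent over `l` to an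
  `l`-smooth point is `l`-smooth (`AreSmoothEquivalent.isSmoothAt_left_of_field'`).
* Bricks: transport of smooth-equivalence data along ring isomorphisms of either model
  (`AreSmoothEquivalent.of_ringEquiv_left/right`; to a smaller base: `comp_base` of
  `InseparableLocalUniformizationCurvesStepOne.lean`);
  smoothness at a prime under an isomorphism of the ground ring (`isSmoothAt_of_ringEquiv_base`);
  the compositum `K₁·l̄` inside an algebraic closure (`exists_compositum`); integrality pivots
  for `Nr_{K₁}(A)` (`isIntegral_nrIn_map_iff`) and the centre of an extension of valuation rings
  (`mk_algebraMap_mem_maximalIdeal_iff`).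

## Sources

* M. Temkin, *Inseparable local uniformization*, arXiv:0804.1554v3: proof of Thm. 4.1.1, Step 4
  (p. 49); Lemma 2.8.5 (p. 31); Definition 2.8.1 and the remark after it (pp. 29–30).
* The Stacks Project, Tag 05B5, field case (via `SmoothDescentField.lean`, proved there).

## Rendering notes

* As in `Temkin2013_Steps34_tower` / `step3_exists_level`: `k̄` acts on `K₁` through `K`; the
  level-`B′` models are `X₁′ = nrIn (A.map (K → K₁))` (for `B′ ⊆ A`, which Step 2/3 arrange:
  `X′ = Nr_K(A·B′)`) and `Y₁′ = nrIn (B′.map (k̄ → m))`, entering as variables with defining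
  equations; the output of Thm. 4.1.1 for `Y′` enters as hypotheses in the shape of
  `Temkin2013DescentFor k k̄ k̄°` (fields `m′ ⊇ m`, `l ⊆ l̄ ⊆ m′`, `m′°`, `NY = Nr_{m′}(B′)` with its
  `l`-smooth centre).
* `L₁ = l̄K₁` is realised as `K₁(ψ(l̄))` inside `Ω = AlgebraicClosure K₁` for a `k̄`-embedding
  `ψ : m′ → Ω`; `l ⊆ L₁` is the copy `ψ(l)`.
-/

noncomputable section

open IsLocalRing

namespace Literature.AlgebraicGeometry.Resolution

universe u

/-! ### Bricks: transporting smooth-equivalence and smoothness along isomorphisms -/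

namespace AreSmoothEquivalent

variable {R₀ A A' B : Type u} [CommRing R₀] [CommRing A] [CommRing A'] [CommRing B]

/-- Smooth-equivalence data are transported along a ring isomorphism of the first model
(an isomorphism is smooth, and smooth maps compose). [folklore] -/
theorem of_ringEquiv_left (e : A ≃+* A') {f : R₀ →+* A} {g : R₀ →+* B} {p : Ideal A}
    {q : Ideal B} {p' : Ideal A'} (hp : p'.comap e.toRingHom = p)
    (h : AreSmoothEquivalent f g p q) :
    AreSmoothEquivalent (e.toRingHom.comp f) g p' q := by
  obtain ⟨D, _, _, _, hcomp, hA, hB, r, hr, hrp, hrq⟩ := h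
  letI : Algebra A' A := e.symm.toRingHom.toAlgebra
  letI algA'D : Algebra A' D := ((algebraMap A D).comp e.symm.toRingHom).toAlgebra
  haveI : IsScalarTower A' A D := IsScalarTower.of_algebraMap_eq fun _ => rfl
  let e' : A' ≃ₐ[A'] A := { e.symm with commutes' := fun _ => rfl }
  haveI : Algebra.FinitePresentation A' A := Algebra.FinitePresentation.equiv e'
  haveI : Algebra.FormallySmooth A' A := Algebra.FormallySmooth.of_equiv e'
  haveI : Algebra.Smooth A' A := ⟨inferInstance, inferInstance⟩
  haveI : Algebra.Smooth A D := hA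
  haveI : Algebra.Smooth A' D := Algebra.Smooth.comp A' A D
  refine ⟨D, inferInstance, algA'D, ‹Algebra B D›, ?_, inferInstance, hB, r, hr, ?_, hrq⟩
  · rw [← hcomp]
    refine RingHom.ext fun x => ?_
    change algebraMap A D (e.symm (e (f x))) = algebraMap A D (f x)
    rw [e.symm_apply_apply]
  · rw [← hrp] at hp
    change r.comap ((algebraMap A D).comp e.symm.toRingHom) = p'
    rw [← Ideal.comap_comap]
    refine Ideal.ext fun x => ?_
    rw [← hp, Ideal.mem_comap, Ideal.mem_comap]
    change e (e.symm x) ∈ p' ↔ x ∈ p'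
    rw [e.apply_symm_apply]

/-- Symmetric form of `of_ringEquiv_left`. [folklore] -/
theorem of_ringEquiv_right {B' : Type u} [CommRing B'] (e : B ≃+* B') {f : R₀ →+* A}
    {g : R₀ →+* B} {p : Ideal A} {q : Ideal B} {q' : Ideal B'} (hq : q'.comap e.toRingHom = q)
    (h : AreSmoothEquivalent f g p q) :
    AreSmoothEquivalent f (e.toRingHom.comp g) p q' :=
  (of_ringEquiv_left e hq h.symm).symm

end AreSmoothEquivalent

/-- **Smoothness at a prime is insensitive to replacing the ground ring by an isomorphic one**:
if `A` is `Λ`-smooth at `p` and `e : Λ′ ≃ Λ`, then `A`, viewed as a `Λ′`-algebra through `e`, is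
`Λ′`-smooth at `p` (`Λ′ → Λ` is formally smooth and formally smooth maps compose). [folklore] -/
theorem isSmoothAt_of_ringEquiv_base {Λ Λ' A : Type u} [CommRing Λ] [CommRing Λ'] [CommRing A]
    [Algebra Λ A] (e : Λ' ≃+* Λ) (p : Ideal A) [p.IsPrime] (h : Algebra.IsSmoothAt Λ p) :
    @Algebra.IsSmoothAt Λ' A _ _ ((algebraMap Λ A).comp e.toRingHom).toAlgebra p _ := by
  letI : Algebra Λ' A := ((algebraMap Λ A).comp e.toRingHom).toAlgebra
  letI : Algebra Λ' Λ := e.toRingHom.toAlgebra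
  haveI : IsScalarTower Λ' Λ A := IsScalarTower.of_algebraMap_eq fun _ => rfl
  haveI : IsScalarTower Λ' Λ (Localization.AtPrime p) := IsScalarTower.of_algebraMap_eq fun x => by
    rw [IsScalarTower.algebraMap_apply Λ A (Localization.AtPrime p),
      IsScalarTower.algebraMap_apply Λ' A (Localization.AtPrime p)]
    rfl
  let e' : Λ' ≃ₐ[Λ'] Λ := { e with commutes' := fun _ => rfl }
  haveI : Algebra.FormallySmooth Λ' Λ := Algebra.FormallySmooth.of_equiv e'
  haveI : Algebra.FormallySmooth Λ (Localization.AtPrime p) := h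
  exact Algebra.FormallySmooth.comp Λ' Λ (Localization.AtPrime p)

/-! ### Bricks: valuation rings, integral closures, composita -/

section valuationBricks

variable {F E : Type u} [Field F] [Field E] [Algebra F E]

/-- **The centre is preserved in an extension of valuation rings**: if `O_E ∩ F = O_F`, an
element of `O_F` lies in the maximal ideal of `O_E` iff it lies in that of `O_F` (units of
`O_F` are the elements whose inverse lies in `O_F = O_E ∩ F`). [folklore] -/
theorem mk_algebraMap_mem_maximalIdeal_iff (OE : ValuationSubring E) (OF : ValuationSubring F)
    (h : OE.comap (algebraMap F E) = OF) (a : F) (ha : a ∈ OF) (ha' : algebraMap F E a ∈ OE) :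
    (⟨algebraMap F E a, ha'⟩ : OE) ∈ maximalIdeal OE ↔ (⟨a, ha⟩ : OF) ∈ maximalIdeal OF := by
  rw [IsLocalRing.mem_maximalIdeal, IsLocalRing.mem_maximalIdeal, mem_nonunits_iff,
    mem_nonunits_iff, not_iff_not]
  by_cases ha0 : a = 0
  · subst ha0
    have h1 : (⟨algebraMap F E 0, ha'⟩ : OE) = 0 := Subtype.ext (map_zero _)
    have h2 : (⟨(0 : F), ha⟩ : OF) = 0 := rfl
    rw [h1, h2]
    exact ⟨fun hu => absurd hu not_isUnit_zero, fun hu => absurd hu not_isUnit_zero⟩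
  constructor
  · intro hu
    have hinv : (algebraMap F E a)⁻¹ ∈ OE := inv_mem_of_isUnit OE ha' hu
    have : a⁻¹ ∈ OF := by
      rw [← h]
      change algebraMap F E a⁻¹ ∈ OE
      rw [map_inv₀]; exact hinv
    exact isUnit_of_inv_mem OF ha this ha0
  · intro hu
    have hinv : a⁻¹ ∈ OF := inv_mem_of_isUnit OF ha hu
    have : (algebraMap F E a)⁻¹ ∈ OE := by
      rw [← map_inv₀]
      rw [← h] at hinv
      exact hinv
    exact isUnit_of_inv_mem OE ha' this ((map_ne_zero _).mpr ha0)

end valuationBricks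

section integralBricks

variable {k K : Type u} [Field k] [Field K] [Algebra k K]

/-- The image of an affine `k`-model in an extension, as a subring. [folklore] -/
theorem map_toAlgHom_toSubring (A : Subalgebra k K) (K₁ : Type u) [Field K₁] [Algebra K K₁]
    [Algebra k K₁] [IsScalarTower k K K₁] :
    (A.map (IsScalarTower.toAlgHom k K K₁)).toSubring = A.toSubring.map (algebraMap K K₁) := by
  ext x; simp [Subring.mem_map]

/-- **Integrality pivot for `X₁ = Nr_{K₁}(X)`**: for `X₁ = Nr_{K₁}(A)` (`A ⊆ K`, `K₁ ⊇ K`) and any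
field `L ⊇ K₁`, an element of `L` is integral over `X₁` iff it is integral over `A`
(transitivity of integrality: `X₁` is integral over `A`). [folklore] -/
theorem isIntegral_nrIn_map_iff (A : Subalgebra k K) (K₁ : Type u) [Field K₁] [Algebra K K₁]
    [Algebra k K₁] [IsScalarTower k K K₁] (X₁ : Subring K₁)
    (hX₁ : X₁ = nrIn (A.toSubring.map (algebraMap K K₁)))
    (L : Type u) [Field L] [Algebra K₁ L] [Algebra K L] [IsScalarTower K K₁ L] (t : L) :
    IsIntegral X₁ t ↔ IsIntegral A t := by
  have hAX : ∀ a : A, algebraMap K K₁ a ∈ X₁ := fun a => by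
    rw [hX₁]; exact le_nrIn _ ⟨a, a.2, rfl⟩
  letI : Algebra A X₁ := (((algebraMap K K₁).comp A.val.toRingHom).codRestrict X₁ hAX).toAlgebra
  haveI : IsScalarTower A X₁ K₁ := IsScalarTower.of_algebraMap_eq fun _ => rfl
  haveI : IsScalarTower A X₁ L := IsScalarTower.of_algebraMap_eq fun a =>
    IsScalarTower.algebraMap_apply K K₁ L (a : K)
  haveI : Algebra.IsIntegral A X₁ := ⟨fun x => by
    have hx : IsIntegral (A.toSubring.map (algebraMap K K₁)) (x : K₁) := hX₁.le x.2
    rw [← map_toAlgHom_toSubring A K₁] at hx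
    have hx' : IsIntegral (A.map (IsScalarTower.toAlgHom k K K₁)) (x : K₁) := hx
    have hx'' : IsIntegral A (x : K₁) := (isIntegral_map_iff A (x : K₁)).mp hx'
    exact (isIntegral_algHom_iff (IsScalarTower.toAlgHom A X₁ K₁) Subtype.val_injective).mp hx''⟩
  exact ⟨fun ht => isIntegral_trans t ht, fun ht => ht.tower_top⟩

/-- `X₁ = Nr_{K₁}(A)` has fraction field `K₁` when `Frac A = K` and `K₁/K` is algebraic.
[folklore] -/
theorem isFractionRing_of_eq_nrIn_map (A : Subalgebra k K) (hAfr : IsFractionRing A K)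
    (K₁ : Type u) [Field K₁] [Algebra K K₁] [Algebra.IsAlgebraic K K₁] [Algebra k K₁]
    [IsScalarTower k K K₁] (X₁ : Subring K₁)
    (hX₁ : X₁ = nrIn (A.toSubring.map (algebraMap K K₁))) : IsFractionRing X₁ K₁ := by
  haveI := hAfr
  refine IsFractionRing.of_field X₁ K₁ fun z => ?_
  have hz : IsAlgebraic A z :=
    (IsFractionRing.isAlgebraic_iff A K K₁).mpr (Algebra.IsAlgebraic.isAlgebraic z)
  obtain ⟨a, ha0, hint⟩ := hz.exists_integral_multiple
  have hmem : a • z ∈ X₁ := by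
    rw [hX₁, mem_nrIn_iff, ← map_toAlgHom_toSubring A K₁]
    exact (isIntegral_map_iff A _).mpr hint
  have haX : algebraMap A K₁ a ∈ X₁ := by
    rw [hX₁]; exact le_nrIn _ ⟨a, a.2, rfl⟩
  refine ⟨⟨a • z, hmem⟩, ⟨algebraMap A K₁ a, haX⟩, ?_⟩
  have ha' : (algebraMap A K₁ a) ≠ 0 :=
    (map_ne_zero_iff _ (FaithfulSMul.algebraMap_injective A K₁)).mpr ha0
  change z = (a • z) / algebraMap A K₁ a
  rw [Algebra.smul_def, eq_div_iff ha', mul_comm]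

/-- A subring of the form `Nr_{K₁}(T)` with fraction field `K₁` is integrally closed.
[folklore] -/
theorem isIntegrallyClosed_of_eq_nrIn {K₁ : Type u} [Field K₁] (X₁ T : Subring K₁)
    (hX₁ : X₁ = nrIn T) [IsFractionRing X₁ K₁] : IsIntegrallyClosed X₁ := by
  refine (isIntegrallyClosed_iff K₁).mpr fun {x} hx => ?_
  have hx' : x ∈ nrIn X₁ := hx
  rw [hX₁, nrIn_nrIn, ← hX₁] at hx'
  exact ⟨⟨x, hx'⟩, rfl⟩

/-- Inside an intermediate field generated by algebraic elements, a subset whose underlying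
elements contain the generators generates the whole field as an algebra. [folklore] -/
theorem algebra_adjoin_eq_top_of_subset {F E : Type u} [Field F] [Field E] [Algebra F E]
    {S : Set E} (hS : ∀ x ∈ S, IsAlgebraic F x) (T : Set (IntermediateField.adjoin F S))
    (hT : S ⊆ Subtype.val '' T) : Algebra.adjoin F T = ⊤ := by
  rw [eq_top_iff]
  rintro x -
  have hx : (x : E) ∈ (IntermediateField.adjoin F S).toSubalgebra := x.2
  rw [IntermediateField.adjoin_toSubalgebra_of_isAlgebraic hS] at hx
  have hle : Algebra.adjoin F S ≤ (Algebra.adjoin F T).map (IntermediateField.adjoin F S).val := by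
    rw [AlgHom.map_adjoin]
    exact Algebra.adjoin_mono hT
  obtain ⟨y, hy, hyx⟩ := Subalgebra.mem_map.mp (hle hx)
  have : y = x := Subtype.val_injective hyx
  rwa [← this]

/-- A finitely generated subalgebra over a field is finitely presented (Hilbert's basis
theorem). [folklore] -/
theorem finitePresentation_of_fg {F L : Type u} [Field F] [CommRing L] [Algebra F L]
    (N : Subalgebra F L) (h : N.FG) : Algebra.FinitePresentation F N := by
  haveI hft : Algebra.FiniteType F N := N.fg_iff_finiteType.mp h
  haveI : IsNoetherianRing F := PrincipalIdealRing.isNoetherianRing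
  exact (Algebra.FinitePresentation.of_finiteType (R := F)).mp hft

end integralBricks

section compositum

/-- **The compositum `K₁·l̄` inside an algebraic closure.** For a finite purely inseparable
`l̄/k̄` inside a `k̄`-field `m′`, a field `K₁ ⊇ k̄` and a `k̄`-embedding `ψ : m′ → Ω` into an
extension `Ω ⊇ K₁` (compatibly with `k̄ → K₁ → Ω`): the intermediate field `L₁ = K₁(ψ(l̄))` is
finite purely inseparable over `K₁`, contains `ψ(l̄)`, and is generated over `K₁` (as an algebra)
by any subset mapping onto `ψ(l̄)` ("the composite extension `l̄K₁` is well defined since `l̄/k̄`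
is purely inseparable", Temkin 2013, proof of Lemma 2.8.5, p. 31). [folklore] -/
theorem exists_compositum {kb m' K₁ Ω : Type u} [Field kb] [Field m'] [Field K₁] [Field Ω]
    [Algebra kb m'] [Algebra kb K₁] [Algebra K₁ Ω] [Algebra kb Ω] [IsScalarTower kb K₁ Ω]
    (q : ℕ) [ExpChar kb q] (lb : IntermediateField kb m') [FiniteDimensional kb lb]
    [IsPurelyInseparable kb lb] (ψ : m' →ₐ[kb] Ω) :
    ∃ L₁ : IntermediateField K₁ Ω, FiniteDimensional K₁ L₁ ∧ IsPurelyInseparable K₁ L₁ ∧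
      (∀ x : lb, ψ x ∈ L₁) ∧
      ∀ T : Set L₁, (∀ x : lb, ∃ t ∈ T, (t : Ω) = ψ x) → Algebra.adjoin K₁ T = ⊤ := by
  classical
  haveI : ExpChar K₁ q := expChar_of_injective_algebraMap (algebraMap kb K₁).injective q
  -- a finite spanning set of `l̄` over `k̄`
  obtain ⟨s, hs⟩ := (Module.Finite.fg_top : (⊤ : Submodule kb lb).FG)
  let S : Set Ω := (fun x : lb => ψ x) '' (s : Set lb)
  haveI : Finite S := Set.Finite.to_subtype ((s.finite_toSet).image _)
  -- every generator has a `qⁿ`-th power in `K₁`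
  have hpow : ∀ x : lb, ∃ n : ℕ, ∃ y : kb, ψ x ^ q ^ n = algebraMap K₁ Ω (algebraMap kb K₁ y) :=
    fun x => by
    obtain ⟨n, y, hy⟩ := IsPurelyInseparable.pow_mem kb q x
    refine ⟨n, y, ?_⟩
    have h1 : ((x : lb) : m') ^ q ^ n = algebraMap kb m' y := by
      have := congrArg (algebraMap lb m') hy
      rw [map_pow, IntermediateField.algebraMap_apply, IntermediateField.algebraMap_apply,
        IntermediateField.coe_algebraMap_apply] at this
      exact this.symm
    rw [← map_pow, h1, AlgHom.commutes, ← IsScalarTower.algebraMap_apply]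
  have hint : ∀ x ∈ S, IsIntegral K₁ x := by
    rintro _ ⟨x, -, rfl⟩
    obtain ⟨n, y, hy⟩ := hpow x
    refine IsIntegral.of_pow (expChar_pow_pos kb q n) ?_
    rw [hy]; exact isIntegral_algebraMap
  refine ⟨IntermediateField.adjoin K₁ S, IntermediateField.finiteDimensional_adjoin hint, ?_, ?_, ?_⟩
  · rw [IntermediateField.isPurelyInseparable_adjoin_iff_pow_mem K₁ Ω q]
    rintro _ ⟨x, -, rfl⟩
    obtain ⟨n, y, hy⟩ := hpow x
    exact ⟨n, algebraMap kb K₁ y, hy.symm⟩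
  · -- `ψ(l̄) ⊆ K₁(S)`: expand along the spanning set
    intro x
    have hx : x ∈ Submodule.span kb (s : Set lb) := by rw [hs]; exact Submodule.mem_top
    induction hx using Submodule.span_induction with
    | mem y hy => exact IntermediateField.subset_adjoin K₁ S ⟨y, hy, rfl⟩
    | zero => simp
    | add y z _ _ hy hz =>
      have : ψ ((y + z : lb) : m') = ψ y + ψ z := by
        rw [← map_add]; rfl
      rw [this]; exact add_mem hy hz
    | smul c y _ hy =>
      have : ψ ((c • y : lb) : m') = algebraMap K₁ Ω (algebraMap kb K₁ c) * ψ y := by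
        rw [← IsScalarTower.algebraMap_apply, ← AlgHom.commutes ψ c, ← map_mul]
        congr 1
        rw [IntermediateField.coe_smul, Algebra.smul_def]
      rw [this]
      exact mul_mem (IntermediateField.algebraMap_mem _ _) hy
  · intro T hT
    refine algebra_adjoin_eq_top_of_subset (fun x hx => (hint x hx).isAlgebraic) T ?_
    rintro _ ⟨x, -, rfl⟩
    obtain ⟨t, ht, htx⟩ := hT x
    exact ⟨t, ht, htx⟩

end compositum

/-! ### Step 4 -/

section stepFour

variable {k K : Type u} [Field k] [Field K] [Algebra k K]

set_option synthInstance.maxHeartbeats 200000 in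
set_option maxHeartbeats 800000 in
/-- **Step 4 of the proof of Temkin's Thm. 4.1.1, up to the final enlargement of `l` — core,
for an abstract compositum `L₁ = l̄K₁`** (Temkin 2013, proof of Thm. 4.1.1, Step 4, p. 49:
"(the new) `yᵢ` is `l`-smooth by the construction and `xᵢ` is still smooth-equivalent to `yᵢ`
by Lemma 2.8.5 … Thus, we achieve that the center of each `Kᵢ` on `Xᵢ` is `l`-smooth"), for
`n = 1`: data as in `Temkin2013_Steps34_tower` after Steps 2–3 (the model `X′ = Spec A` of `K°`;
`X₁′ = Nr_{K₁}(X′)`, `Y₁′ = Nr_m(Y′)` for the affine model `Y′ = Spec B′` of `k̄°`; the level-`B′`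
smooth-equivalence of the centres `x`, `y` of `K₁°`, `m°` over `Y′`), the output of Thm. 4.1.1
for `Y′`, `k̄°` and `(m, m°)` in the shape of `Temkin2013DescentFor` (`m′ = l̄m`, `l ⊆ l̄ ⊆ m′`,
`m′°`, `NY = Nr_{m′}(Y′)` with `l`-smooth centre), and a field `L₁ ⊇ K₁`, finite purely
inseparable, generated over `K₁` by a compatible image of `l̄`, with the copy `l′ ≅ l` of `l`
inside it and a valuation ring `L₁°` over `K₁°`. Conclusion:
`Temkin2013DescentConclusionWeak k K K° A K₁ K₁°` — `L = K(l̄)`, `N = Nr_{L₁}(X′)` with `l′`-smooth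
centre. PROVED from `Temkin2013_Lemma285_normal_holds` and `SmoothDescentField.lean`: `x′` and `y′` lie over
`x` and `y` (`X₁′`, `Y₁′` are normal), so they are smooth-equivalent over `Y′` by Lemma 2.8.5;
hence over `Spec k` and — the common smooth cover being reduced and `l′/k` purely inseparable —
over `Spec l′` (`AreSmoothEquivalent.of_comp_of_forall_pow_mem`), and a point smooth-equivalent
over `l′` to an `l′`-smooth point is `l′`-smooth (`AreSmoothEquivalent.isSmoothAt_left_of_field'`,
the proved field case of Tag 05B5). [cite: Temkin2013, proof of Thm. 4.1.1, Step 4 (arXiv:0804.1554v3 p. 49)] -/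
theorem step4_core
    (O : ValuationSubring K) (kb : IntermediateField k K)
    (B' : Subalgebra k kb) (hB'fr : IsFractionRing B' kb)
    (A : Subalgebra k K) (hAO : A.toSubring ≤ O.toSubring) (hAfg : A.FG)
    (hAfr : IsFractionRing A K)
    (K₁ : Type u) [Field K₁] [Algebra K K₁] [FiniteDimensional K K₁]
    (O₁ : ValuationSubring K₁) (hO₁ : O₁.comap (algebraMap K K₁) = O)
    (m : Type u) [Field m] [Algebra kb m] [FiniteDimensional kb m] (Om : ValuationSubring m)
    (m' : Type u) [Field m'] [Algebra m m'] [Algebra kb m'] [Algebra k m'] [IsScalarTower kb m m']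
    [IsScalarTower k kb m'] [FiniteDimensional m m']
    (l : IntermediateField k m')
    (lb : IntermediateField kb m') (hllb : (l : Set m') ⊆ lb) [IsPurelyInseparable kb lb]
    (hadj : Algebra.adjoin m (lb : Set m') = ⊤)
    (Om' : ValuationSubring m') (hOm' : Om'.comap (algebraMap m m') = Om)
    (NY : Subalgebra l m') (hNY : NY.toSubring ≤ Om'.toSubring)
    (hNYcar : (NY : Set m') = {x | IsIntegral (B'.map (IsScalarTower.toAlgHom k kb m')) x})
    (hsmY : Algebra.IsSmoothAt l (centreIdeal NY Om' hNY))
    (X₁ : Subring K₁) (hX₁ : X₁ = nrIn (A.toSubring.map (algebraMap K K₁)))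
    (Y₁ : Subring m) (hY₁ : Y₁ = nrIn (B'.toSubring.map (algebraMap kb m)))
    (hX : X₁ ≤ O₁.toSubring) (hY : Y₁ ≤ Om.toSubring)
    (hBX : ∀ b : B'.toSubring, ((algebraMap kb K₁).comp B'.toSubring.subtype) b ∈ X₁)
    (hBY : ∀ b : B'.toSubring, ((algebraMap kb m).comp B'.toSubring.subtype) b ∈ Y₁)
    (hSE : AreSmoothEquivalent
      (((algebraMap kb K₁).comp B'.toSubring.subtype).codRestrict X₁ hBX)
      (((algebraMap kb m).comp B'.toSubring.subtype).codRestrict Y₁ hBY)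
      ((maximalIdeal O₁).comap (Subring.inclusion hX))
      ((maximalIdeal Om).comap (Subring.inclusion hY)))
    (L₁ : Type u) [Field L₁] [Algebra K₁ L₁] [Algebra K L₁] [IsScalarTower K K₁ L₁]
    [Algebra k L₁] [IsScalarTower k K L₁] [FiniteDimensional K₁ L₁] [IsPurelyInseparable K₁ L₁]
    [Algebra lb L₁]
    (htow : ∀ c : kb, algebraMap lb L₁ (algebraMap kb lb c) = algebraMap K L₁ (c : K))
    (hK' : Algebra.adjoin K₁ (Set.range (algebraMap lb L₁)) = ⊤)
    (l' : IntermediateField k L₁) [FiniteDimensional k l'] [IsPurelyInseparable k l']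
    (el : l ≃ₐ[k] l') (hel : ∀ y : l, ((el y : l') : L₁) = algebraMap lb L₁ ⟨y, hllb y.2⟩)
    (O₁' : ValuationSubring L₁) (hO₁' : O₁'.comap (algebraMap K₁ L₁) = O₁) :
    Temkin2013DescentConclusionWeak k K O A K₁ O₁ := by
  classical
  ------------------------------------------------------------------
  -- characteristic, scalar structures
  ------------------------------------------------------------------
  obtain ⟨q, hq⟩ := ExpChar.exists k
  haveI hqkb : ExpChar kb q := expChar_of_injective_algebraMap (algebraMap k kb).injective q
  haveI hqK : ExpChar K q := expChar_of_injective_algebraMap (algebraMap k K).injective q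
  letI algkK₁ : Algebra k K₁ := ((algebraMap K K₁).comp (algebraMap k K)).toAlgebra
  haveI : IsScalarTower k K K₁ := IsScalarTower.of_algebraMap_eq fun _ => rfl
  haveI : Algebra.IsAlgebraic K K₁ := Algebra.IsAlgebraic.of_finite K K₁
  letI algkm : Algebra k m := ((algebraMap kb m).comp (algebraMap k kb)).toAlgebra
  haveI : IsScalarTower k kb m := IsScalarTower.of_algebraMap_eq fun _ => rfl
  haveI : FiniteDimensional kb m' := Module.Finite.trans m m'
  haveI : Algebra.IsAlgebraic kb m := Algebra.IsAlgebraic.of_finite kb m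
  haveI : FiniteDimensional kb lb := inferInstance
  have hmemO₁' : ∀ x : K₁, algebraMap K₁ L₁ x ∈ O₁' ↔ x ∈ O₁ := fun x => by
    rw [← hO₁']; rfl
  have hmemOm' : ∀ x : m, algebraMap m m' x ∈ Om' ↔ x ∈ Om := fun x => by
    rw [← hOm']; rfl
  ------------------------------------------------------------------
  -- the models `X₁′ = Nr_{K₁}(X′)` and `Y₁′ = Nr_m(Y′)` as rings over `B′`
  ------------------------------------------------------------------
  letI algBX : Algebra B'.toSubring X₁ :=
    (((algebraMap kb K₁).comp B'.toSubring.subtype).codRestrict X₁ hBX).toAlgebra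
  letI algBY : Algebra B'.toSubring Y₁ :=
    (((algebraMap kb m).comp B'.toSubring.subtype).codRestrict Y₁ hBY).toAlgebra
  haveI : IsScalarTower B'.toSubring X₁ K₁ := IsScalarTower.of_algebraMap_eq fun _ => rfl
  haveI : IsScalarTower B'.toSubring Y₁ m := IsScalarTower.of_algebraMap_eq fun _ => rfl
  haveI : IsScalarTower B'.toSubring K₁ L₁ := IsScalarTower.of_algebraMap_eq fun b =>
    IsScalarTower.algebraMap_apply K K₁ L₁ ((b : kb) : K)
  haveI : IsScalarTower B'.toSubring X₁ L₁ := IsScalarTower.of_algebraMap_eq fun b =>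
    IsScalarTower.algebraMap_apply K K₁ L₁ ((b : kb) : K)
  haveI : IsScalarTower B'.toSubring Y₁ m' := IsScalarTower.of_algebraMap_eq fun b =>
    IsScalarTower.algebraMap_apply kb m m' (b : kb)
  haveI : FaithfulSMul B'.toSubring X₁ :=
    (faithfulSMul_iff_algebraMap_injective _ _).mpr fun a b hab => by
      have h1 : algebraMap kb K₁ a = algebraMap kb K₁ b := congrArg (fun x : X₁ => (x : K₁)) hab
      exact Subtype.ext ((algebraMap kb K₁).injective h1)
  haveI : FaithfulSMul B'.toSubring Y₁ :=
    (faithfulSMul_iff_algebraMap_injective _ _).mpr fun a b hab => by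
      have h1 : algebraMap kb m a = algebraMap kb m b := congrArg (fun x : Y₁ => (x : m)) hab
      exact Subtype.ext ((algebraMap kb m).injective h1)
  haveI hB'pfr : IsFractionRing B'.toSubring kb := by
    haveI := hB'fr
    refine IsFractionRing.of_field B'.toSubring kb fun z => ?_
    obtain ⟨a, b, -, rfl⟩ := IsFractionRing.div_surjective (A := B') z
    exact ⟨⟨a, a.2⟩, ⟨b, b.2⟩, rfl⟩
  haveI hX₁fr : IsFractionRing X₁ K₁ := isFractionRing_of_eq_nrIn_map A hAfr K₁ X₁ hX₁
  haveI hY₁fr : IsFractionRing Y₁ m := isFractionRing_of_eq_nrIn_map B' hB'fr m Y₁ hY₁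
  haveI : IsIntegrallyClosed X₁ := isIntegrallyClosed_of_eq_nrIn X₁ _ hX₁
  haveI : IsIntegrallyClosed Y₁ := isIntegrallyClosed_of_eq_nrIn Y₁ _ hY₁
  -- `l̄` over `B′`
  haveI : IsScalarTower B'.toSubring lb L₁ := IsScalarTower.of_algebraMap_eq fun b =>
    (htow (b : kb)).symm
  have hM' : Algebra.adjoin m (Set.range (algebraMap lb m')) = ⊤ := by
    have : Set.range (algebraMap lb m') = (lb : Set m') := by
      ext x; exact ⟨fun ⟨y, hy⟩ => hy ▸ y.2, fun hx => ⟨⟨x, hx⟩, rfl⟩⟩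
    rw [this]; exact hadj
  ------------------------------------------------------------------
  -- the points `x`, `y` and their preimages `x′`, `y′` in `Nr_{L₁}(X₁′)`, `Nr_{m′}(Y₁′)`
  ------------------------------------------------------------------
  haveI hxp : ((maximalIdeal O₁).comap (Subring.inclusion hX)).IsPrime := Ideal.comap_isPrime _ _
  haveI hyp : ((maximalIdeal Om).comap (Subring.inclusion hY)).IsPrime := Ideal.comap_isPrime _ _
  have hTO : ∀ t : integralClosure X₁ L₁, (t : L₁) ∈ O₁' := fun t => by
    have hXO : ∀ x : X₁, algebraMap X₁ L₁ x ∈ O₁'.toSubring := fun x => (hmemO₁' x).mpr (hX x.2)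
    letI : Algebra X₁ O₁' := ((algebraMap X₁ L₁).codRestrict O₁'.toSubring hXO).toAlgebra
    haveI : IsScalarTower X₁ O₁' L₁ := IsScalarTower.of_algebraMap_eq fun _ => rfl
    have ht : IsIntegral O₁' (t : L₁) := (t.2 : IsIntegral X₁ (t : L₁)).tower_top
    obtain ⟨z, hz⟩ := IsIntegrallyClosed.algebraMap_eq_of_integral ht
    rw [← hz]; exact z.2
  have hT'O : ∀ t : integralClosure Y₁ m', (t : m') ∈ Om' := fun t => by
    have hYO : ∀ y : Y₁, algebraMap Y₁ m' y ∈ Om'.toSubring := fun y => (hmemOm' y).mpr (hY y.2)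
    letI : Algebra Y₁ Om' := ((algebraMap Y₁ m').codRestrict Om'.toSubring hYO).toAlgebra
    haveI : IsScalarTower Y₁ Om' m' := IsScalarTower.of_algebraMap_eq fun _ => rfl
    have ht : IsIntegral Om' (t : m') := (t.2 : IsIntegral Y₁ (t : m')).tower_top
    obtain ⟨z, hz⟩ := IsIntegrallyClosed.algebraMap_eq_of_integral ht
    rw [← hz]; exact z.2
  let iT : integralClosure X₁ L₁ →+* O₁'.toSubring :=
    (integralClosure X₁ L₁).val.toRingHom.codRestrict O₁'.toSubring hTO
  let iT' : integralClosure Y₁ m' →+* Om'.toSubring :=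
    (integralClosure Y₁ m').val.toRingHom.codRestrict Om'.toSubring hT'O
  haveI hx'p : ((maximalIdeal O₁').comap iT).IsPrime := Ideal.comap_isPrime _ _
  haveI hy'p : ((maximalIdeal Om').comap iT').IsPrime := Ideal.comap_isPrime _ _
  have hx'x : ((maximalIdeal O₁').comap iT).comap (algebraMap X₁ (integralClosure X₁ L₁)) =
      (maximalIdeal O₁).comap (Subring.inclusion hX) := by
    refine Ideal.ext fun a => ?_
    rw [Ideal.mem_comap, Ideal.mem_comap, Ideal.mem_comap]
    exact mk_algebraMap_mem_maximalIdeal_iff O₁' O₁ hO₁' (a : K₁) (hX a.2) _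
  have hy'y : ((maximalIdeal Om').comap iT').comap (algebraMap Y₁ (integralClosure Y₁ m')) =
      (maximalIdeal Om).comap (Subring.inclusion hY) := by
    refine Ideal.ext fun a => ?_
    rw [Ideal.mem_comap, Ideal.mem_comap, Ideal.mem_comap]
    exact mk_algebraMap_mem_maximalIdeal_iff Om' Om hOm' (a : m) (hY a.2) _
  ------------------------------------------------------------------
  -- Lemma 2.8.5 (corrected rendering, discharged)
  ------------------------------------------------------------------
  have h285 := Temkin2013_Lemma285_normal_holds B'.toSubring kb lb inferInstance inferInstance
    X₁ K₁ L₁ hK' Y₁ m m' hM' _ _ hxp hyp hSE _ _ hx'p hy'p hx'x hy'y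
  ------------------------------------------------------------------
  -- `N = Nr_{L₁}(X′)` as an `l′`-subalgebra of `L₁`
  ------------------------------------------------------------------
  have hAO₁' : (A.map (IsScalarTower.toAlgHom k K L₁)).toSubring ≤ O₁'.toSubring := by
    rintro _ ⟨a, ha, rfl⟩
    change algebraMap K L₁ a ∈ O₁'
    rw [IsScalarTower.algebraMap_apply K K₁ L₁, hmemO₁']
    have : (a : K) ∈ O₁.comap (algebraMap K K₁) := by rw [hO₁]; exact hAO ha
    exact this
  have hl'int : ∀ c : l', IsIntegral (A.map (IsScalarTower.toAlgHom k K L₁)) ((c : L₁)) :=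
    fun c => by
    have h1 : IsIntegral k ((c : l') : L₁) :=
      (Algebra.IsIntegral.isIntegral (R := k) c).map (IsScalarTower.toAlgHom k l' L₁)
    exact h1.tower_top
  let N : Subalgebra l' L₁ :=
    { carrier := {x | IsIntegral (A.map (IsScalarTower.toAlgHom k K L₁)) x}
      mul_mem' := fun ha hb => ha.mul hb
      one_mem' := isIntegral_one
      add_mem' := fun ha hb => ha.add hb
      zero_mem' := isIntegral_zero
      algebraMap_mem' := fun c => hl'int c }
  have hmemN : ∀ x, x ∈ N ↔ IsIntegral (A.map (IsScalarTower.toAlgHom k K L₁)) x :=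
    fun _ => Iff.rfl
  have hN : N.toSubring ≤ O₁'.toSubring := fun x hx =>
    mem_valuationSubring_of_isIntegral O₁' _ hAO₁' ((hmemN x).mp hx)
  ------------------------------------------------------------------
  -- `Nr_{L₁}(X₁′) = N` and `Nr_{m′}(Y₁′) = NY`
  ------------------------------------------------------------------
  have hTN : ∀ t : L₁, t ∈ integralClosure X₁ L₁ ↔ t ∈ N := fun t => by
    rw [mem_integralClosure_iff, hmemN, isIntegral_map_iff A t]
    exact isIntegral_nrIn_map_iff A K₁ X₁ hX₁ L₁ t
  have hT'NY : ∀ t : m', t ∈ integralClosure Y₁ m' ↔ t ∈ NY := fun t => by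
    rw [mem_integralClosure_iff, ← SetLike.mem_coe, hNYcar, Set.mem_setOf_eq, isIntegral_map_iff B' t]
    exact isIntegral_nrIn_map_iff B' m Y₁ hY₁ m' t
  let eN : integralClosure X₁ L₁ ≃+* N :=
    { toFun := fun t => ⟨t.1, (hTN t.1).mp t.2⟩
      invFun := fun x => ⟨x.1, (hTN x.1).mpr x.2⟩
      left_inv := fun _ => rfl
      right_inv := fun _ => rfl
      map_mul' := fun _ _ => rfl
      map_add' := fun _ _ => rfl }
  let eNY : integralClosure Y₁ m' ≃+* NY :=
    { toFun := fun t => ⟨t.1, (hT'NY t.1).mp t.2⟩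
      invFun := fun x => ⟨x.1, (hT'NY x.1).mpr x.2⟩
      left_inv := fun _ => rfl
      right_inv := fun _ => rfl
      map_mul' := fun _ _ => rfl
      map_add' := fun _ _ => rfl }
  have hPN : (centreIdeal N O₁' hN).comap eN.toRingHom = (maximalIdeal O₁').comap iT :=
    Ideal.ext fun _ => Iff.rfl
  have hPNY : (centreIdeal NY Om' hNY).comap eNY.toRingHom = (maximalIdeal Om').comap iT' :=
    Ideal.ext fun _ => Iff.rfl
  have h2 := AreSmoothEquivalent.of_ringEquiv_right eNY hPNY
    (AreSmoothEquivalent.of_ringEquiv_left eN hPN h285)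
  ------------------------------------------------------------------
  -- from the base `Y′` to the base `Spec k`, then to `Spec l′` (radicial)
  ------------------------------------------------------------------
  let φk : k →+* B'.toSubring :=
    (algebraMap k kb).codRestrict B'.toSubring fun c => B'.algebraMap_mem c
  have h3 := h2.comp_base φk
  letI algl'NY : Algebra l' NY :=
    ((algebraMap l NY).comp el.symm.toRingEquiv.toRingHom).toAlgebra
  have halgl'NY : ∀ c : l', ((algebraMap l' NY c : NY) : m') = ((el.symm c : l) : m') :=
    fun _ => rfl
  have hf : (eN.toRingHom.comp (algebraMap B'.toSubring (integralClosure X₁ L₁))).comp φk =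
      (algebraMap l' N).comp (algebraMap k l') := by
    refine RingHom.ext fun c => Subtype.ext ?_
    change algebraMap K L₁ (((φk c : B'.toSubring) : kb) : K) =
      ((algebraMap k l' c : l') : L₁)
    rw [IntermediateField.coe_algebraMap_apply]
    change algebraMap K L₁ ((algebraMap k kb c : kb) : K) = algebraMap k L₁ c
    rw [IntermediateField.coe_algebraMap_apply, ← IsScalarTower.algebraMap_apply]
  have hg : (eNY.toRingHom.comp (algebraMap B'.toSubring (integralClosure Y₁ m'))).comp φk =
      (algebraMap l' NY).comp (algebraMap k l') := by
    refine RingHom.ext fun c => Subtype.ext ?_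
    change algebraMap kb m' (algebraMap k kb c) = ((algebraMap l' NY (algebraMap k l' c) : NY) : m')
    rw [halgl'NY, AlgEquiv.commutes, IntermediateField.coe_algebraMap_apply,
      ← IsScalarTower.algebraMap_apply]
  rw [hf, hg] at h3
  have hφ : ∀ x : l', ∃ n : ℕ, x ^ q ^ n ∈ (algebraMap k l').range := fun x =>
    IsPurelyInseparable.pow_mem k q x
  have h4 := AreSmoothEquivalent.of_comp_of_forall_pow_mem q (algebraMap k N) (algebraMap k l')
    hφ (algebraMap l' N) (algebraMap l' NY) h3
  ------------------------------------------------------------------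
  -- descent of smoothness (Tag 05B5, field case): the centre of `L₁°` on `N` is `l′`-smooth
  ------------------------------------------------------------------
  haveI : FiniteDimensional K L₁ := Module.Finite.trans K₁ L₁
  obtain ⟨N₀, hN₀set, hN₀fg, -, -⟩ := exists_normalisation_in_extension A hAfg hAfr L₁
  have hNN₀ : N.restrictScalars k = N₀ := by
    apply SetLike.ext'
    rw [Subalgebra.coe_restrictScalars, hN₀set]
    rfl
  have hNfg : (N.restrictScalars k).FG := by rw [hNN₀]; exact hN₀fg
  -- `N` is finitely generated over `l′` by the `k`-generators of `N₀`
  obtain ⟨sN, hsN⟩ := hN₀fg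
  have hNadj : Algebra.adjoin l' (sN : Set L₁) = N := by
    apply le_antisymm
    · refine Algebra.adjoin_le fun x hx => ?_
      have hx' : x ∈ N₀ := by rw [← hsN]; exact Algebra.subset_adjoin hx
      rw [← hNN₀] at hx'
      exact hx'
    · intro x hx
      have hx' : x ∈ N₀ := by rw [← hNN₀]; exact hx
      rw [← hsN] at hx'
      have hle : Algebra.adjoin k (sN : Set L₁) ≤
          (Algebra.adjoin l' (sN : Set L₁)).restrictScalars k :=
        Algebra.adjoin_le Algebra.subset_adjoin
      exact hle hx'
  haveI hftN : Algebra.FiniteType l' N := N.fg_iff_finiteType.mp ⟨sN, hNadj⟩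
  have hq' : Algebra.IsSmoothAt l' (centreIdeal NY Om' hNY) :=
    isSmoothAt_of_ringEquiv_base el.symm.toRingEquiv (centreIdeal NY Om' hNY) hsmY
  have hsm : Algebra.IsSmoothAt l' (centreIdeal N O₁' hN) :=
    AreSmoothEquivalent.isSmoothAt_left_of_field' h4 (fun D _ _ _ hcomp _ _ => hcomp) hq'
  ------------------------------------------------------------------
  -- packaging: `L = K(l̄)`, `Frac N = L₁`
  ------------------------------------------------------------------
  let Lf : IntermediateField K L₁ := IntermediateField.adjoin K (Set.range (algebraMap lb L₁))
  have hl'L : (l' : Set L₁) ⊆ (Lf : Set L₁) := fun x hx => by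
    have hx' : x = ((el (el.symm ⟨x, hx⟩) : l') : L₁) := by rw [el.apply_symm_apply]
    rw [hx', hel]
    exact IntermediateField.subset_adjoin K _ ⟨_, rfl⟩
  have hLpi : IsPurelyInseparable K Lf := by
    rw [IntermediateField.isPurelyInseparable_adjoin_iff_pow_mem K L₁ q]
    rintro _ ⟨x, rfl⟩
    obtain ⟨n, y, hy⟩ := IsPurelyInseparable.pow_mem kb q x
    refine ⟨n, algebraMap kb K y, ?_⟩
    rw [← map_pow, ← hy, htow]
    rfl
  have hLadj : Algebra.adjoin K₁ (Lf : Set L₁) = ⊤ :=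
    eq_top_iff.mpr (hK' ▸ Algebra.adjoin_mono (IntermediateField.subset_adjoin K _))
  haveI : Algebra.IsAlgebraic K L₁ := Algebra.IsAlgebraic.of_finite K L₁
  have hNfr : IsFractionRing N L₁ := by
    haveI := hAfr
    refine IsFractionRing.of_field N L₁ fun z => ?_
    have hz : IsAlgebraic A z :=
      (IsFractionRing.isAlgebraic_iff A K L₁).mpr (Algebra.IsAlgebraic.isAlgebraic z)
    obtain ⟨a, ha0, hint⟩ := hz.exists_integral_multiple
    refine ⟨⟨a • z, (hmemN _).mpr ((isIntegral_map_iff A _).mpr hint)⟩,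
      ⟨algebraMap A L₁ a, (hmemN _).mpr ((isIntegral_map_iff A _).mpr isIntegral_algebraMap)⟩, ?_⟩
    have ha' : algebraMap A L₁ a ≠ 0 :=
      (map_ne_zero_iff _ (FaithfulSMul.algebraMap_injective A L₁)).mpr ha0
    change z = (a • z) / algebraMap A L₁ a
    rw [Algebra.smul_def, eq_div_iff ha', mul_comm]
  exact ⟨L₁, inferInstance, inferInstance, inferInstance, inferInstance, inferInstance,
    inferInstance, inferInstance, inferInstance, l', inferInstance, inferInstance, Lf, hl'L, hLpi,
    hLadj, A, le_rfl, hAO, hAfg, hAfr, O₁', hO₁', N, hN, rfl, hNfg, hNfr, hsm⟩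

set_option synthInstance.maxHeartbeats 200000 in
set_option maxHeartbeats 400000 in
/-- **Step 4 of the proof of Temkin's Thm. 4.1.1, up to the final enlargement of `l`**
(Temkin 2013, proof of Thm. 4.1.1, Step 4, p. 49: "Next, we extend `k̄` as follows: replace
`k̄`, `mᵢ`, `K`, `Kᵢ` with `l̄`, `l̄mᵢ`, `l̄K`, `l̄Kᵢ`, respectively … Then (the new) `yᵢ` is
`l`-smooth by the construction and `xᵢ` is still smooth-equivalent to `yᵢ` by Lemma 2.8.5 …
Thus, we achieve that the center of each `Kᵢ` on `Xᵢ` is `l`-smooth"), for `n = 1`: data as in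
`Temkin2013_Steps34_tower` after Steps 2–3 (the model `X′ = Spec A` of `K°`, `X₁′ = Nr_{K₁}(X′)`,
`Y₁′ = Nr_m(Y′)` for the affine model `Y′ = Spec B′` of `k̄°`; the level-`B′` smooth-equivalence
of the centres `x`, `y` of `K₁°`, `m°` over `Y′`, delivered by `step3_exists_level`), plus the
output of Thm. 4.1.1 for `Y′`, `k̄°` and `(m, m°)` in the shape of `Temkin2013DescentFor`
(`m′ = l̄m`, `l ⊆ l̄ ⊆ m′`, `m′°`, `NY = Nr_{m′}(Y′)` with `l`-smooth centre). Conclusion: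
`Temkin2013DescentConclusionWeak k K K° A K₁ K₁°`, with `L₁ = l̄K₁` realised inside an algebraic
closure of `K₁` ("the composite extension `l̄K₁` is well defined since `l̄/k̄` is purely
inseparable"), `L = l̄K`, `N = Nr_{L₁}(X′)` and the `l`-smooth centre of `L₁°`. PROVED,
unconditionally, from `Temkin2013_Lemma285_normal_holds` and `SmoothDescentField.lean`
(`step4_core`). [cite: Temkin2013, proof of Thm. 4.1.1, Step 4 (arXiv:0804.1554v3 p. 49)] -/
theorem step4_weakConclusion
    (O : ValuationSubring K) (kb : IntermediateField k K)
    (B' : Subalgebra k kb) (hB'fr : IsFractionRing B' kb)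
    (A : Subalgebra k K) (hAO : A.toSubring ≤ O.toSubring) (hAfg : A.FG)
    (hAfr : IsFractionRing A K)
    (K₁ : Type u) [Field K₁] [Algebra K K₁] [FiniteDimensional K K₁]
    (O₁ : ValuationSubring K₁) (hO₁ : O₁.comap (algebraMap K K₁) = O)
    (m : Type u) [Field m] [Algebra kb m] [FiniteDimensional kb m] (Om : ValuationSubring m)
    (m' : Type u) [Field m'] [Algebra m m'] [Algebra kb m'] [Algebra k m'] [IsScalarTower kb m m']
    [IsScalarTower k kb m'] [FiniteDimensional m m']
    (l : IntermediateField k m') [FiniteDimensional k l] [IsPurelyInseparable k l]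
    (lb : IntermediateField kb m') (hllb : (l : Set m') ⊆ lb) [IsPurelyInseparable kb lb]
    (hadj : Algebra.adjoin m (lb : Set m') = ⊤)
    (Om' : ValuationSubring m') (hOm' : Om'.comap (algebraMap m m') = Om)
    (NY : Subalgebra l m') (hNY : NY.toSubring ≤ Om'.toSubring)
    (hNYcar : (NY : Set m') = {x | IsIntegral (B'.map (IsScalarTower.toAlgHom k kb m')) x})
    (hsmY : Algebra.IsSmoothAt l (centreIdeal NY Om' hNY))
    (X₁ : Subring K₁) (hX₁ : X₁ = nrIn (A.toSubring.map (algebraMap K K₁)))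
    (Y₁ : Subring m) (hY₁ : Y₁ = nrIn (B'.toSubring.map (algebraMap kb m)))
    (hX : X₁ ≤ O₁.toSubring) (hY : Y₁ ≤ Om.toSubring)
    (hBX : ∀ b : B'.toSubring, ((algebraMap kb K₁).comp B'.toSubring.subtype) b ∈ X₁)
    (hBY : ∀ b : B'.toSubring, ((algebraMap kb m).comp B'.toSubring.subtype) b ∈ Y₁)
    (hSE : AreSmoothEquivalent
      (((algebraMap kb K₁).comp B'.toSubring.subtype).codRestrict X₁ hBX)
      (((algebraMap kb m).comp B'.toSubring.subtype).codRestrict Y₁ hBY)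
      ((maximalIdeal O₁).comap (Subring.inclusion hX))
      ((maximalIdeal Om).comap (Subring.inclusion hY))) :
    Temkin2013DescentConclusionWeak k K O A K₁ O₁ := by
  classical
  obtain ⟨q, hq⟩ := ExpChar.exists k
  haveI hqkb : ExpChar kb q := expChar_of_injective_algebraMap (algebraMap k kb).injective q
  letI algkK₁ : Algebra k K₁ := ((algebraMap K K₁).comp (algebraMap k K)).toAlgebra
  haveI : IsScalarTower k K K₁ := IsScalarTower.of_algebraMap_eq fun _ => rfl
  haveI : IsScalarTower k kb K₁ := IsScalarTower.of_algebraMap_eq fun c => by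
    change (algebraMap K K₁) (algebraMap k K c) = algebraMap kb K₁ (algebraMap k kb c)
    rw [IsScalarTower.algebraMap_apply kb K K₁, ← IsScalarTower.algebraMap_apply k kb K]
  haveI : FiniteDimensional kb m' := Module.Finite.trans m m'
  haveI : Algebra.IsAlgebraic kb m' := Algebra.IsAlgebraic.of_finite kb m'
  haveI : FiniteDimensional kb lb := inferInstance
  ------------------------------------------------------------------
  -- the compositum `L₁ = l̄K₁` inside an algebraic closure of `K₁`
  ------------------------------------------------------------------
  let Ω := AlgebraicClosure K₁
  let ψ : m' →ₐ[kb] Ω := IsAlgClosed.lift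
  obtain ⟨L₁f, hL₁fin, hL₁pi, hψlb, hgen⟩ := exists_compositum (K₁ := K₁) (Ω := Ω) q lb ψ
  haveI := hL₁fin
  haveI := hL₁pi
  haveI : IsScalarTower k kb Ω := IsScalarTower.of_algebraMap_eq fun c => by
    rw [IsScalarTower.algebraMap_apply k K₁ Ω, IsScalarTower.algebraMap_apply k kb K₁,
      ← IsScalarTower.algebraMap_apply kb K₁ Ω]
  haveI : IsScalarTower k K L₁f := IsScalarTower.of_algebraMap_eq fun c => by
    apply Subtype.ext
    change algebraMap k Ω c = algebraMap K Ω (algebraMap k K c)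
    rw [IsScalarTower.algebraMap_apply k K₁ Ω, IsScalarTower.algebraMap_apply K K₁ Ω]
    rfl
  -- `l̄` acting on `L₁` through `ψ`
  letI alglbL₁ : Algebra lb L₁f :=
    ((ψ.toRingHom.comp (algebraMap lb m')).codRestrict L₁f (fun x => hψlb x)).toAlgebra
  have halglb : ∀ x : lb, ((algebraMap lb L₁f x : L₁f) : Ω) = ψ x := fun _ => rfl
  have htow : ∀ c : kb, algebraMap lb L₁f (algebraMap kb lb c) = algebraMap K L₁f (c : K) :=
    fun c => by
    apply Subtype.ext
    rw [halglb]
    change ψ (algebraMap kb m' c) = algebraMap K Ω (c : K)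
    rw [AlgHom.commutes]
    rfl
  have hK' : Algebra.adjoin K₁ (Set.range (algebraMap lb L₁f)) = ⊤ :=
    hgen _ fun x => ⟨algebraMap lb L₁f x, ⟨x, rfl⟩, halglb x⟩
  -- the valuation ring `L₁°` over `K₁°`
  obtain ⟨O₁', hO₁'⟩ := exists_valuationSubring_comap_eq (Ω := L₁f) O₁
  ------------------------------------------------------------------
  -- the copy `l′ ⊆ L₁` of `l` and the identification `l ≃ l′`
  ------------------------------------------------------------------
  let ψk : m' →ₐ[k] Ω := ψ.restrictScalars k
  let valk : L₁f →ₐ[k] Ω := (L₁f.val).restrictScalars k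
  let l' : IntermediateField k L₁f := (l.map ψk).comap valk
  have hmeml' : ∀ x : L₁f, x ∈ l' ↔ ∃ y ∈ l, ψ y = (x : Ω) := fun x =>
    IntermediateField.mem_map l
  have hψl : ∀ y : l, ψ y ∈ L₁f := fun y => hψlb ⟨y, hllb y.2⟩
  have halgkL : ∀ c : k, ((algebraMap k L₁f c : L₁f) : Ω) = algebraMap k Ω c := fun _ => rfl
  let fl : l →ₐ[k] l' :=
    { toFun := fun y => ⟨⟨ψ y, hψl y⟩, (hmeml' _).mpr ⟨y, y.2, rfl⟩⟩
      map_one' := Subtype.ext (Subtype.ext (by simp))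
      map_mul' := fun a b => Subtype.ext (Subtype.ext (by simp))
      map_zero' := Subtype.ext (Subtype.ext (by simp))
      map_add' := fun a b => Subtype.ext (Subtype.ext (by simp))
      commutes' := fun c => Subtype.ext (Subtype.ext (by
        change ψ (algebraMap k m' c) = ((algebraMap k L₁f c : L₁f) : Ω)
        rw [halgkL]
        exact ψk.commutes c)) }
  have hfl : ∀ y : l, (((fl y : l') : L₁f) : Ω) = ψ y := fun _ => rfl
  have hfl_inj : Function.Injective fl := fun a b hab => by
    have h1 : ψ a = ψ b := by rw [← hfl, ← hfl, hab]
    exact Subtype.ext (ψ.toRingHom.injective h1)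
  have hfl_surj : Function.Surjective fl := fun z => by
    obtain ⟨y, hy, hyz⟩ := (hmeml' z).mp z.2
    exact ⟨⟨y, hy⟩, Subtype.ext (Subtype.ext hyz)⟩
  let el : l ≃ₐ[k] l' := AlgEquiv.ofBijective fl ⟨hfl_inj, hfl_surj⟩
  haveI : FiniteDimensional k l' := LinearEquiv.finiteDimensional el.toLinearEquiv
  haveI : IsPurelyInseparable k l' := AlgEquiv.isPurelyInseparable el
  have hel : ∀ y : l, ((el y : l') : L₁f) = algebraMap lb L₁f ⟨y, hllb y.2⟩ := fun _ =>
    Subtype.ext rfl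
  exact step4_core O kb B' hB'fr A hAO hAfg hAfr K₁ O₁ hO₁ m Om m' l lb hllb hadj Om' hOm' NY
    hNY hNYcar hsmY X₁ hX₁ Y₁ hY₁ hX hY hBX hBY hSE L₁f htow hK' l' el hel O₁' hO₁'

end stepFour

end Literature.AlgebraicGeometry.Resolution
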